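import Literature.Analysis.FluidPDE.NSUniqueness2D
import Literature.Analysis.FluidPDE.LerayHopfSpectralMeasurability
import Literature.Analysis.FluidPDE.NSWeakStrongUniqueness
import HarnessLib

/-!
# Navier–Stokes on `𝕋²`: the Lions–Prodi uniqueness theorem reduced to two named inputs

Trunk: FluidKinetic (`Literature/Analysis/FluidPDE`). This file decomposes the named fact
`Literature.Analysis.FluidPDE.lions_prodi_uniqueness_torus2` (`NSUniqueness2D`; Lions–Prodi 1959;
Foias–Manley–Rosa–Temam 2001, Ch. II, Thm. 7.3; Constantin–Foias 1988, Thm. 10.1;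
Kuksin–Shirikyan 2012, Thm. 2.1.13) along the printed proof into two named sub-results and
**proves the assembly** `lions_prodi_uniqueness_torus2_of_parts`.

The printed proof (Constantin–Foias 1988, proof of Thm. 10.1, PDF pp. 53–54; Kuksin–Shirikyan
2012, proof of Thm. 2.1.13, PDF p. 52; Temam 1984, Ch. III, Thm. 3.2): for two solutions `u, v`
with the same data put `w = u - v`; the equation for `w` tested with `w` itself (legitimate in two
dimensions, where `∂ₜw ∈ L²(0,T;V')`) gives the energy identity
`½ d/dt |w|² + ν‖w‖² = -b(w, u, w)` (CF (10.5), KS (2.26)); the trilinear term is bounded with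
**Ladyzhenskaya's inequality** `‖w‖_{L⁴} ≤ c |w|^{1/2} ‖w‖^{1/2}_{H¹}` (KS (1.8)); Young's
inequality absorbs the dissipation and Grönwall's lemma with the integrable kernel concludes.

* `Literature.Analysis.FluidPDE.ladyzhenskaya_torus2` — Ladyzhenskaya's inequality on the flat
  unit torus `𝕋²` in `ℝ≥0∞` form: `∫|w|⁴ ≤ C (∫|w|²) ‖w‖²_{H¹}` for `w ∈ L²(𝕋²; ℝ²)`, the `H¹`
  norm being the tree's spectral `Torus.eSobolevNorm 1` of the complexified field
  (Kuksin–Shirikyan 2012, Example 1.1.5, (1.8): "`|u|₄ ≤ C₂ √(|u|₂ ‖u‖₁)` for any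
  `u ∈ H¹(Q; ℝⁿ)` … This is Ladyzhenskaya's inequality", `Q = 𝕋²`, `‖·‖₁` the full `H¹` norm).
* `Literature.Analysis.FluidPDE.lions_prodi_difference_ineq_torus2` — the **energy inequality
  for the difference of two Leray–Hopf solutions** with the same data on `𝕋² × [0,T)`:
  `|w(t)|² + 2ν ∫₀ᵗ ‖∇w‖² ≤ 2 ∫₀ᵗ ‖v‖_{L⁴} ‖w‖_{L⁴} ‖∇w‖₂` for every `t ∈ (0, T]`
  (CF (10.5) integrated on `(0,t)`, with `b(w,v,w) = 0`, i.e. KS (2.26) with (2.11)–(2.12), and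
  the Hölder bound `|b(w, w, v)| ≤ ‖v‖₄ ‖w‖₄ ‖∇w‖₂`, KS (2.16) first line), in `ℝ≥0∞` form with
  the spectral dissipation `Torus.eGradNormSq`.

The assembly `lions_prodi_uniqueness_torus2_of_parts : ladyzhenskaya_torus2 →
lions_prodi_difference_ineq_torus2 → lions_prodi_uniqueness_torus2` is a real proof: the two
inputs give, pointwise in time, `2‖v‖₄‖w‖₄‖∇w‖₂ ≤ ν‖∇w‖² + (ν + 16 C ν⁻³ ‖v‖₄⁴) |w|²` (Young with
exponents `4/3, 4`, `‖w‖²_{H¹} ≤ |w|² + ‖∇w‖²`); the dissipation `ν∫₀ᵗ‖∇w‖²` is finite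
(`w ∈ L²(0,T;H¹)`) and is absorbed; the kernel `‖v(s)‖₄⁴ ≤ C |v(s)|² ‖v(s)‖²_{H¹}` is integrable on
`(0, T)` because `|v(s)|²` is bounded on `[0, T]` (energy inequality from `0` plus the finiteness of
the forcing work `∫₀ᵀ |∫⟪f, v⟫|`) and `v ∈ L²(0,T;H¹)`; `|w(t)|²` is bounded likewise, and the
integral Grönwall lemma with an `L¹` kernel (`FluidPDE.lintegral_gronwall_eq_zero`,
Robinson–Rodrigo–Sadowski 2016, Lemma A.25) gives `|w(t)|² = 0`, i.e. `u(t) = v(t)` a.e., for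
every `t ∈ (0, T]`.

## Contents

* `ladyzhenskaya_torus2`, `lions_prodi_difference_ineq_torus2` — the two named facts.
* `Torus.eGradNormSq_sub_le` — spectral bookkeeping, `‖∇(v-w)‖² ≤ 2‖∇v‖² + 2‖∇w‖²`.
* `Torus.IsLerayHopfOn.aemeasurable_lintegral_enorm_pow` — time measurability of `∫⁻‖u(s)‖ₑ^p`
  (the dissipation `s ↦ ‖∇u(s)‖₂²` is measurable and integrable by the accepted
  `IsLerayHopfOn.aemeasurable_eGradNormSq`, `IsLerayHopfOn.lintegral_eGradNormSq_lt_top`).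
* `Torus.IsLerayHopfOn.integrableOn_work`, `….exists_forall_lintegral_enorm_sq_le` — the forcing
  work `s ↦ ∫⟪f(s), u(s)⟫` is integrable on `(0,T)` and `|u(t)|²` is bounded on `[0, T]`.
* `ENNReal.mul_rpow_three_quarters_le` — Young's inequality `A B^{3/4} ≤ ε B + ε⁻³ A⁴`.
* `lions_prodi_uniqueness_torus2_of_parts` — the assembly.

## Mathlib / tree search

Mathlib (this pin) has no Navier–Stokes theory and no Ladyzhenskaya inequality (searched
`Ladyzhenskaya`, `ladyzhenskaya`: tree docstrings only); Gagliardo–Nirenberg–Sobolev for `C¹_c`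
functions on `ℝⁿ` is `MeasureTheory.eLpNorm_le_eLpNorm_fderiv_one`. The tree has the `ℝ³`
whole-space weak–strong uniqueness programme (`NSWeakStrongUniqueness`, `NSSerrinUniqueness`),
whose Grönwall lemma is reused here; on the torus it has the time-sliced weak formulation and the
spectral measurability of Leray–Hopf solutions (`LerayHopfTimeSliceTorus`,
`LerayHopfSpectralMeasurability`, `DissipationAnomalyProofs`), reused here, but no uniqueness
statement (searched `unique`, `Torus.*IsLerayHopfOn`).

## References

* C. Foias, O. Manley, R. Rosa, R. Temam, *Navier–Stokes Equations and Turbulence*, CUP 2001,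
  Ch. II §7, Thm. 7.3 (PDF p. 72), p. 70. [FoiasManleyRosaTemam2001]
* P. Constantin, C. Foias, *Navier–Stokes Equations*, Chicago 1988, Thm. 10.1 and its proof,
  (10.3)–(10.6) (PDF pp. 53–54). [ConstantinFoias1988]
* S. Kuksin, A. Shirikyan, *Mathematics of Two-Dimensional Turbulence*, CUP 2012, Example 1.1.5
  (1.8) (PDF p. 15), Prop. 2.1.7 (2.11)–(2.16) (PDF p. 50), Thm. 2.1.13 and its proof (PDF p. 52).
  [KuksinShirikyan2012]
* R. Temam, *Navier–Stokes Equations*, 3rd ed., North-Holland 1984, Ch. III, Lemma 3.3, Thm. 3.2.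
  [Temam1984]
* J. C. Robinson, J. L. Rodrigo, W. Sadowski, *The three-dimensional Navier–Stokes equations*,
  CUP 2016, Lemma A.25. [RobinsonRodrigoSadowski2016]
-/

noncomputable section

open MeasureTheory Set Filter Function
open scoped ENNReal NNReal InnerProductSpace RealInnerProductSpace Topology

namespace Literature.Analysis.FluidPDE

/-- Local notation for the flat unit two-torus `𝕋² = UnitAddTorus (Fin 2)`. -/
local notation "𝕋²" => UnitAddTorus (Fin 2)
/-- Local notation for velocity values `ℝ² = EuclideanSpace ℝ (Fin 2)`. -/
local notation "ℝ²" => EuclideanSpace ℝ (Fin 2)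

/-! ### The two named inputs -/

/-- **Ladyzhenskaya's inequality on the flat unit torus `𝕋²`** (Ladyzhenskaya 1958/1969, Ch. I
§1, Lemma 1; Temam 1984, Ch. III, Lemma 3.3; Foias–Manley–Rosa–Temam 2001, (A.47);
Kuksin–Shirikyan 2012, Example 1.1.5, (1.8): "`|u|₄ ≤ C₂ √(|u|₂ ‖u‖₁)` for any `u ∈ H¹(Q; ℝⁿ)`",
`Q` the torus `𝕋²`, `‖u‖₁² = ∑ₛ (1 + |s|²)|uₛ|²` the *full* `H¹` norm — on the torus without a
mean-zero normalisation the homogeneous form is false for constants). Rendering, fourth power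
and `ℝ≥0∞`: there is a constant `C` such that for every `w ∈ L²(𝕋²; ℝ²)`,
`∫ |w|⁴ ≤ C · (∫ |w|²) · ‖w‖²_{H¹}` with `‖w‖_{H¹} = Torus.eSobolevNorm 1 (complexify ∘ w)` the
tree's spectral `H¹` norm (`= (∑ₖ (1+|k|²) |ŵ(k)|²)^{1/2}`); both sides may be `∞` (the
inequality is then trivial), and for `w ∉ L²` the Fourier side is junk, whence the hypothesis
`MemLp w 2`. [cite: KuksinShirikyan2012, Example 1.1.5 (1.8)] -/
def ladyzhenskaya_torus2 : Prop :=
  ∃ C : ℝ≥0, ∀ w : 𝕋² → ℝ², MemLp w 2 volume →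
    ∫⁻ x, ‖w x‖ₑ ^ 4 ≤ (C : ℝ≥0∞) * (∫⁻ x, ‖w x‖ₑ ^ 2) *
      FunctionSpaces.Torus.eSobolevNorm 1 (FunctionSpaces.EuclideanSpace.complexify ∘ w) ^ 2

/-- **The energy inequality for the difference of two Leray–Hopf solutions in two dimensions**
(Constantin–Foias 1988, proof of Thm. 10.1, (10.3)–(10.5): `½ d/dt|w|² + ν‖w‖² + b(w,u₂,w) = 0`
for `w = u₁ - u₂`, "then (10.5) takes place almost for every `t`"; Kuksin–Shirikyan 2012, proof
of Thm. 2.1.13, (2.25)–(2.26) with (2.10)–(2.12) and the Hölder step of (2.16),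
`|⟨B(u,w),v⟩| ≤ C₂ |∇w|₂ |u|₄ |v|₄`; Temam 1984, Ch. III, proof of Thm. 3.2). Rendering on the
flat unit torus in the vocabulary of the accepted `Torus.IsLerayHopfOn`: let `ν > 0`, `T > 0`,
`f` space–time measurable with `∫₀ᵀ∫‖f‖² < ∞`, `u₀ ∈ L²` weakly divergence free, and let `u`,
`v` be Leray–Hopf weak solutions on `𝕋² × [0,T)` with these data. Then for every `t ∈ (0, T]`,
with `w = u - v`,
`∫ |w(t)|² + 2ν ∫₀ᵗ ‖∇w(s)‖₂² ds ≤ 2 ∫₀ᵗ ‖v(s)‖_{L⁴} ‖w(s)‖_{L⁴} ‖∇w(s)‖₂ ds`,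
all terms in `ℝ≥0∞` (`‖·‖_{L⁴} = (∫⁻ ‖·‖ₑ⁴)^{1/4}`, `‖∇·‖₂² = Torus.eGradNormSq`, the spectral
dissipation). The slice `t = 0` is excluded as in `lions_prodi_uniqueness_torus2`. In the tree
this is obtained from the Galerkin-truncated energy identity for `w` (time-sliced weak
formulation, Parseval) in the limit of infinitely many modes, the trilinear term with two equal
arguments vanishing by weak incompressibility. [cite: ConstantinFoias1988, Thm. 10.1 (proof, (10.3)–(10.5))] -/
def lions_prodi_difference_ineq_torus2 : Prop :=
  ∀ (ν T : ℝ) (_hν : 0 < ν) (_hT : 0 < T) (f : ℝ → 𝕋² → ℝ²)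
    (_hf : AEStronglyMeasurable (FunctionSpaces.Torus.stLift f) (volume.restrict (Ioo 0 T ×ˢ univ)))
    (_hf₂ : ∫⁻ t in Ioo 0 T, ∫⁻ x, ‖f t x‖ₑ ^ 2 < ∞) (u₀ : 𝕋² → ℝ²)
    (_hu₀ : MemLp u₀ 2 volume) (_hdiv : FunctionSpaces.Torus.IsWeaklyDivFree u₀) (u v : ℝ → 𝕋² → ℝ²)
    (_hu : Torus.IsLerayHopfOn T ν f u₀ u) (_hv : Torus.IsLerayHopfOn T ν f u₀ v),
    ∀ t ∈ Ioc 0 T,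
      (∫⁻ x, ‖u t x - v t x‖ₑ ^ 2) +
          2 * ENNReal.ofReal ν * ∫⁻ s in Ioo 0 t, FunctionSpaces.Torus.eGradNormSq (u s - v s) ≤
        2 * ∫⁻ s in Ioo 0 t, (∫⁻ x, ‖v s x‖ₑ ^ 4) ^ (1 / 4 : ℝ) *
          (∫⁻ x, ‖u s x - v s x‖ₑ ^ 4) ^ (1 / 4 : ℝ) *
            FunctionSpaces.Torus.eGradNormSq (u s - v s) ^ (1 / 2 : ℝ)

/-! ### Spectral bookkeeping on `T^d` -/

namespace Torus

section General

variable {d : Type*} [Fintype d] [DecidableEq d]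

omit [DecidableEq d] in
/-- The spectral dissipation of a difference: `‖∇(v - w)‖₂² ≤ 2‖∇v‖₂² + 2‖∇w‖₂²` for integrable
fields (termwise `‖a - b‖² ≤ 2‖a‖² + 2‖b‖²` on the Fourier side). [folklore] -/
theorem eGradNormSq_sub_le {v w : UnitAddTorus d → EuclideanSpace ℝ d} (hv : Integrable v volume)
    (hw : Integrable w volume) :
    FunctionSpaces.Torus.eGradNormSq (v - w) ≤
      2 * FunctionSpaces.Torus.eGradNormSq v + 2 * FunctionSpaces.Torus.eGradNormSq w := by
  rw [FunctionSpaces.Torus.eGradNormSq_eq_tsum, FunctionSpaces.Torus.eGradNormSq_eq_tsum,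
    FunctionSpaces.Torus.eGradNormSq_eq_tsum]
  set c : ℝ≥0∞ := ENNReal.ofReal (4 * Real.pi ^ 2) with hc
  set F : (UnitAddTorus d → EuclideanSpace ℝ d) → (d → ℤ) → ℝ≥0∞ := fun φ k =>
    ENNReal.ofReal (FunctionSpaces.Torus.freqNormSq k) *
      ‖UnitAddTorus.mFourierCoeff (FunctionSpaces.EuclideanSpace.complexify ∘ φ) k‖ₑ ^ 2 with hF
  have hterm : ∀ k, F (v - w) k ≤ 2 * F v k + 2 * F w k := by
    intro k
    simp only [hF]
    rw [Torus.mFourierCoeff_complexify_sub hv hw k, mul_left_comm 2, mul_left_comm 2, ← mul_add]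
    exact mul_le_mul' le_rfl (enorm_sub_sq_le_two_mul _ _)
  calc c * ∑' k, F (v - w) k ≤ c * ∑' k, (2 * F v k + 2 * F w k) :=
        mul_le_mul' le_rfl (ENNReal.tsum_le_tsum hterm)
    _ = 2 * (c * ∑' k, F v k) + 2 * (c * ∑' k, F w k) := by
        rw [ENNReal.tsum_add, ENNReal.tsum_mul_left, ENNReal.tsum_mul_left]; ring

variable {T ν : ℝ} {f u : ℝ → UnitAddTorus d → EuclideanSpace ℝ d}
  {u₀ : UnitAddTorus d → EuclideanSpace ℝ d}

/-- Time-measurability of `s ↦ ∫⁻ ‖u(s)‖ₑ^p` for a Leray–Hopf solution (Tonelli). [folklore] -/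
theorem IsLerayHopfOn.aemeasurable_lintegral_enorm_pow (hu : IsLerayHopfOn T ν f u₀ u) (p : ℕ) :
    AEMeasurable (fun s => ∫⁻ x, ‖u s x‖ₑ ^ p) (volume.restrict (Ioo 0 T)) :=
  (hu.aestronglyMeasurable_uncurry.aemeasurable.enorm.pow_const p).lintegral_prod_right'

/-- **The forcing work is integrable in time**: for a Leray–Hopf solution `u` with a space–time
square-integrable force `f`, `s ↦ ∫ ⟪f(s), u(s)⟫` is integrable on `(0, T)`
(`|⟪f,u⟫| ≤ ½(‖f‖² + ‖u‖²)`, `∫‖u(s)‖²` bounded a.e., `s ↦ ∫‖f(s)‖²` integrable). [folklore] -/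
theorem IsLerayHopfOn.integrableOn_work (hu : IsLerayHopfOn T ν f u₀ u)
    (hfm : AEStronglyMeasurable (FunctionSpaces.Torus.stLift f) (volume.restrict (Ioo 0 T ×ˢ univ)))
    (hf₂ : ∫⁻ t in Ioo 0 T, ∫⁻ x, ‖f t x‖ₑ ^ 2 < ∞) :
    IntegrableOn (fun s => ∫ x, ⟪f s x, u s x⟫) (Ioo 0 T) := by
  obtain ⟨C, hC0, hC⟩ := hu.exists_integral_norm_sq_le
  have hu' := hu.aestronglyMeasurable_uncurry
  have hf' : AEStronglyMeasurable (uncurry f) ((volume.restrict (Ioo 0 T)).prod volume) := by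
    have h := FunctionSpaces.Torus.aestronglyMeasurable_uncurry_of_stLift_restrict hfm
    rwa [Measure.volume_eq_prod, ← Measure.prod_restrict, Measure.restrict_univ] at h
  have hf2' : ∫⁻ p, ‖uncurry f p‖ₑ ^ 2 ∂((volume.restrict (Ioo 0 T)).prod volume) < ∞ := by
    rw [lintegral_prod _ (hf'.enorm.pow_const 2)]
    exact hf₂
  have hfL2 : MemLp (uncurry f) 2 ((volume.restrict (Ioo 0 T)).prod volume) :=
    ⟨hf', (eLpNorm_lt_top_iff_lintegral_rpow_enorm_lt_top two_ne_zero ENNReal.ofNat_ne_top).2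
      (by simpa only [ENNReal.toReal_ofNat, ENNReal.rpow_two] using hf2')⟩
  have hfsq : Integrable (fun s => ∫ x, ‖f s x‖ ^ 2) (volume.restrict (Ioo 0 T)) :=
    (hfL2.integrable_norm_pow two_ne_zero).integral_prod_left
  have hfs : ∀ᵐ s ∂(volume.restrict (Ioo 0 T)), MemLp (f s) 2 volume := by
    have hmeas : ∀ᵐ s ∂(volume.restrict (Ioo 0 T)), AEStronglyMeasurable (f s) volume :=
      hf'.prodMk_left
    have hint : AEMeasurable (fun s => ∫⁻ x, ‖f s x‖ₑ ^ 2) (volume.restrict (Ioo 0 T)) :=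
      (hf'.aemeasurable.enorm.pow_const 2).lintegral_prod_right'
    have hfin : ∀ᵐ s ∂(volume.restrict (Ioo 0 T)), ∫⁻ x, ‖f s x‖ₑ ^ 2 < ∞ :=
      ae_lt_top' hint hf₂.ne
    filter_upwards [hmeas, hfin] with s hs hs'
    exact ⟨hs, (eLpNorm_lt_top_iff_lintegral_rpow_enorm_lt_top two_ne_zero
      ENNReal.ofNat_ne_top).2 (by simpa only [ENNReal.toReal_ofNat, ENNReal.rpow_two] using hs')⟩
  have hmeas : AEStronglyMeasurable (fun s => ∫ x, ⟪f s x, u s x⟫) (volume.restrict (Ioo 0 T)) := by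
    have h1 : AEStronglyMeasurable (fun p : ℝ × UnitAddTorus d => ⟪uncurry f p, uncurry u p⟫)
        ((volume.restrict (Ioo 0 T)).prod volume) := hf'.inner hu'
    exact h1.integral_prod_right'
  refine ⟨hmeas, ?_⟩
  have hdom : ∀ᵐ s ∂(volume.restrict (Ioo 0 T)),
      ‖∫ x, ⟪f s x, u s x⟫‖ ≤ 2⁻¹ * ((∫ x, ‖f s x‖ ^ 2) + C) := by
    filter_upwards [hC, hfs, ae_restrict_mem measurableSet_Ioo] with s hs hfs2 hsI
    have hmem : MemLp (u s) 2 volume := hu.memLp s (Ioo_subset_Icc_self hsI)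
    have i1 := hfs2.integrable_norm_pow two_ne_zero
    have i2 := hmem.integrable_norm_pow two_ne_zero
    calc ‖∫ x, ⟪f s x, u s x⟫‖ ≤ ∫ x, ‖⟪f s x, u s x⟫‖ := norm_integral_le_integral_norm _
      _ ≤ ∫ x, 2⁻¹ * (‖f s x‖ ^ 2 + ‖u s x‖ ^ 2) := by
          refine integral_mono_of_nonneg (ae_of_all _ fun x => norm_nonneg _)
            ((i1.add i2).const_mul _) (ae_of_all _ fun x => ?_)
          dsimp only
          rw [Real.norm_eq_abs]
          refine (abs_real_inner_le_norm _ _).trans ?_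
          nlinarith [sq_nonneg (‖f s x‖ - ‖u s x‖)]
      _ = 2⁻¹ * ((∫ x, ‖f s x‖ ^ 2) + ∫ x, ‖u s x‖ ^ 2) := by
          rw [integral_const_mul, integral_add i1 i2]
      _ ≤ 2⁻¹ * ((∫ x, ‖f s x‖ ^ 2) + C) := by gcongr
  refine HasFiniteIntegral.mono' (g := fun s => 2⁻¹ * ((∫ x, ‖f s x‖ ^ 2) + C)) ?_ hdom
  exact ((hfsq.add (integrable_const C)).const_mul _).hasFiniteIntegral

/-- **`|u(t)|²` is bounded on `[0, T]`** for a Leray–Hopf solution with `ν ≥ 0` and a space–time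
square-integrable force: by the energy inequality from `0`,
`½∫|u(t)|² ≤ ½∫|u₀|² + ∫₀ᵗ∫⟪f,u⟫ ≤ ½∫|u₀|² + ∫₀ᵀ|∫⟪f,u⟫|` for **every** `t ∈ [0,T]`
(Leray 1934, (5.2); Galdi 2000, Def. 2.1 (ii)). [folklore] -/
theorem IsLerayHopfOn.exists_forall_lintegral_enorm_sq_le (hu : IsLerayHopfOn T ν f u₀ u)
    (hν : 0 ≤ ν)
    (hfm : AEStronglyMeasurable (FunctionSpaces.Torus.stLift f) (volume.restrict (Ioo 0 T ×ˢ univ)))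
    (hf₂ : ∫⁻ t in Ioo 0 T, ∫⁻ x, ‖f t x‖ₑ ^ 2 < ∞) :
    ∃ M : ℝ≥0∞, M ≠ ∞ ∧ ∀ t ∈ Icc 0 T, ∫⁻ x, ‖u t x‖ₑ ^ 2 ≤ M := by
  have hW := hu.integrableOn_work hfm hf₂
  set W : ℝ → ℝ := fun s => ∫ x, ⟪f s x, u s x⟫ with hWdef
  set B : ℝ := ∫ s in Ioo 0 T, ‖W s‖ with hB
  have hB0 : 0 ≤ B := integral_nonneg fun s => norm_nonneg _
  refine ⟨ENNReal.ofReal (2 * (FunctionSpaces.Torus.kineticEnergy u₀ + B)), ENNReal.ofReal_ne_top,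
    fun t ht => ?_⟩
  have hWt : IntegrableOn W (Ioc 0 t) :=
    (integrableOn_Ioc_iff_integrableOn_Ioo (f := W) (a := 0) (b := t)).2
      (hW.mono_set (Ioo_subset_Ioo le_rfl ht.2))
  -- the forcing work up to time `t` is at most `B`
  have hwork : ∫ τ in (0 : ℝ)..t, W τ ≤ B := by
    rw [intervalIntegral.integral_of_le ht.1]
    calc ∫ τ in Ioc 0 t, W τ ≤ ‖∫ τ in Ioc 0 t, W τ‖ := Real.le_norm_self _
      _ ≤ ∫ τ in Ioc 0 t, ‖W τ‖ := norm_integral_le_integral_norm _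
      _ ≤ ∫ τ in Ioc 0 T, ‖W τ‖ := by
          refine setIntegral_mono_set ?_ (ae_of_all _ fun s => norm_nonneg _)
            (ae_of_all _ (Ioc_subset_Ioc_right ht.2))
          exact ((integrableOn_Ioc_iff_integrableOn_Ioo (f := W) (a := 0) (b := T)).2 hW).norm
      _ = B := by rw [hB, integral_Ioc_eq_integral_Ioo]
  have hE := hu.energy_ineq_zero t ht
  have hkin : FunctionSpaces.Torus.kineticEnergy (u t) ≤ FunctionSpaces.Torus.kineticEnergy u₀ + B := by
    have hdiss : 0 ≤ ν * (∫⁻ τ in Ioo 0 t, FunctionSpaces.Torus.eGradNormSq (u τ)).toReal :=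
      mul_nonneg hν ENNReal.toReal_nonneg
    linarith
  rw [Torus.lintegral_enorm_sq_eq_ofReal (hu.memLp t ht)]
  refine ENNReal.ofReal_le_ofReal ?_
  have : ∫ x, ‖u t x‖ ^ 2 = 2 * FunctionSpaces.Torus.kineticEnergy (u t) := by
    rw [FunctionSpaces.Torus.kineticEnergy]; ring
  rw [this]
  linarith

end General

end Torus

/-! ### Young's inequality with exponents `4/3` and `4` -/

/-- **Young's inequality, `ℝ≥0∞` form used for the absorption step**: for `ε ∈ (0, ∞)`,
`A · B^{3/4} ≤ ε B + ε⁻³ A⁴` (`A B^{3/4} = (A ε^{-3/4})(ε^{3/4} B^{3/4})` and `ab ≤ a⁴/4 + 3b^{4/3}/4`).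
[folklore] -/
theorem _root_.ENNReal.mul_rpow_three_quarters_le (A B ε : ℝ≥0∞) (hε : ε ≠ 0) (hε' : ε ≠ ∞) :
    A * B ^ (3 / 4 : ℝ) ≤ ε * B + ε⁻¹ ^ (3 : ℝ) * A ^ (4 : ℝ) := by
  set a : ℝ≥0∞ := A * ε⁻¹ ^ (3 / 4 : ℝ) with ha
  set b : ℝ≥0∞ := ε ^ (3 / 4 : ℝ) * B ^ (3 / 4 : ℝ) with hb
  have hεε : ε⁻¹ ^ (3 / 4 : ℝ) * ε ^ (3 / 4 : ℝ) = 1 := by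
    rw [← ENNReal.mul_rpow_of_nonneg _ _ (by norm_num : (0 : ℝ) ≤ 3 / 4),
      ENNReal.inv_mul_cancel hε hε', ENNReal.one_rpow]
  have hAB : A * B ^ (3 / 4 : ℝ) = a * b := by
    calc A * B ^ (3 / 4 : ℝ) = A * (ε⁻¹ ^ (3 / 4 : ℝ) * ε ^ (3 / 4 : ℝ)) * B ^ (3 / 4 : ℝ) := by
          rw [hεε, mul_one]
      _ = a * b := by rw [ha, hb]; ring
  have hpq : (4 : ℝ).HolderConjugate (4 / 3) := by
    rw [Real.holderConjugate_iff]
    norm_num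
  have ha4 : a ^ (4 : ℝ) = ε⁻¹ ^ (3 : ℝ) * A ^ (4 : ℝ) := by
    rw [ha, ENNReal.mul_rpow_of_nonneg _ _ (by norm_num : (0 : ℝ) ≤ 4), ← ENNReal.rpow_mul]
    norm_num
    ring
  have hb43 : b ^ (4 / 3 : ℝ) = ε * B := by
    rw [hb, ENNReal.mul_rpow_of_nonneg _ _ (by norm_num : (0 : ℝ) ≤ 4 / 3), ← ENNReal.rpow_mul,
      ← ENNReal.rpow_mul]
    norm_num
  calc A * B ^ (3 / 4 : ℝ) = a * b := hAB
    _ ≤ a ^ (4 : ℝ) / ENNReal.ofReal 4 + b ^ (4 / 3 : ℝ) / ENNReal.ofReal (4 / 3) :=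
        ENNReal.young_inequality a b hpq
    _ ≤ a ^ (4 : ℝ) + b ^ (4 / 3 : ℝ) := by
        gcongr
        · refine ENNReal.div_le_of_le_mul (le_mul_of_one_le_right zero_le ?_)
          rw [← ENNReal.ofReal_one]
          exact ENNReal.ofReal_le_ofReal (by norm_num)
        · refine ENNReal.div_le_of_le_mul (le_mul_of_one_le_right zero_le ?_)
          rw [← ENNReal.ofReal_one]
          exact ENNReal.ofReal_le_ofReal (by norm_num)
    _ = ε * B + ε⁻¹ ^ (3 : ℝ) * A ^ (4 : ℝ) := by rw [ha4, hb43, add_comm]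

/-! ### The assembly -/

/-- **Lions–Prodi uniqueness from Ladyzhenskaya's inequality and the difference energy
inequality** (the printed proof: Constantin–Foias 1988, proof of Thm. 10.1, (10.5)–(10.6);
Kuksin–Shirikyan 2012, proof of Thm. 2.1.13; Temam 1984, Ch. III, Thm. 3.2;
Foias–Manley–Rosa–Temam 2001, Ch. II, Thm. 7.3, uniqueness clause). Pointwise in time,
`2‖v‖₄‖w‖₄‖∇w‖₂ ≤ 2C^{1/4}‖v‖₄ |w|^{1/2} (|w|² + ‖∇w‖²)^{3/4} ≤ ν(|w|² + ‖∇w‖²) + 16Cν⁻³‖v‖₄⁴|w|²`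
(Ladyzhenskaya, `‖w‖²_{H¹} ≤ |w|² + ‖∇w‖²`, Young); the finite dissipation `ν∫₀ᵗ‖∇w‖²` is
absorbed, leaving `|w(t)|² ≤ ∫₀ᵗ (ν + 16Cν⁻³‖v‖₄⁴)|w|²` with an `L¹(0,T)` kernel
(`‖v‖₄⁴ ≤ C |v|² ‖v‖²_{H¹}`, `|v(s)|²` bounded on `[0,T]`, `v ∈ L²(0,T;H¹)`) and a bounded
`|w(t)|²`; the integral Grönwall lemma `FluidPDE.lintegral_gronwall_eq_zero`
(Robinson–Rodrigo–Sadowski 2016, Lemma A.25) forces `|w(t)|² = 0` on `(0, T]`, i.e. `u(t) = v(t)`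
a.e. [cite: FoiasManleyRosaTemam2001, Ch. II Thm. 7.3] -/
theorem lions_prodi_uniqueness_torus2_of_parts (hA : ladyzhenskaya_torus2)
    (hD : lions_prodi_difference_ineq_torus2) : lions_prodi_uniqueness_torus2 := by
  intro ν T hν hT f hfm hf₂ u₀ hu₀ hdiv u v hu hv
  obtain ⟨C, hCA⟩ := hA
  have HD := hD ν T hν hT f hfm hf₂ u₀ hu₀ hdiv u v hu hv
  -- ### notation
  set y : ℝ → ℝ≥0∞ := fun s => ∫⁻ x, ‖u s x - v s x‖ₑ ^ 2 with hy
  set g : ℝ → ℝ≥0∞ := fun s => FunctionSpaces.Torus.eGradNormSq (u s - v s) with hg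
  set V : ℝ → ℝ≥0∞ := fun s => ∫⁻ x, ‖v s x‖ₑ ^ 4 with hV
  set νe : ℝ≥0∞ := ENNReal.ofReal ν with hνe
  have hνe0 : νe ≠ 0 := by rw [hνe]; simpa using hν
  have hνetop : νe ≠ ∞ := ENNReal.ofReal_ne_top
  set K : ℝ≥0∞ := νe⁻¹ ^ (3 : ℝ) * (16 * C) with hK
  have hKtop : K ≠ ∞ :=
    ENNReal.mul_ne_top (ENNReal.rpow_ne_top_of_nonneg (by norm_num) (ENNReal.inv_ne_top.2 hνe0))
      (ENNReal.mul_ne_top ENNReal.ofNat_ne_top ENNReal.coe_ne_top)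
  set a : ℝ → ℝ≥0∞ := fun s => νe + K * V s with ha
  -- ### slices
  have hwL2 : ∀ s ∈ Icc 0 T, MemLp (u s - v s) 2 volume := fun s hs =>
    (hu.memLp s hs).sub (hv.memLp s hs)
  have hy_eq : ∀ s, y s = ∫⁻ x, ‖(u s - v s) x‖ₑ ^ 2 := fun s => rfl
  -- ### measurability in time
  have hu' := hu.aestronglyMeasurable_uncurry
  have hv' := hv.aestronglyMeasurable_uncurry
  have hy_meas : AEMeasurable y (volume.restrict (Ioo 0 T)) :=
    ((hu'.sub hv').aemeasurable.enorm.pow_const 2).lintegral_prod_right'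
  have hV_meas : AEMeasurable V (volume.restrict (Ioo 0 T)) := hv.aemeasurable_lintegral_enorm_pow 4
  have ha_meas : AEMeasurable a (volume.restrict (Ioo 0 T)) := (hV_meas.const_mul K).const_add νe
  -- ### finiteness of the dissipation of the difference
  have hgu := hu.lintegral_eGradNormSq_lt_top
  have hgv := hv.lintegral_eGradNormSq_lt_top
  have hg_le : ∀ s ∈ Ioo 0 T, g s ≤ 2 * FunctionSpaces.Torus.eGradNormSq (u s) +
      2 * FunctionSpaces.Torus.eGradNormSq (v s) := fun s hs =>
    Torus.eGradNormSq_sub_le ((hu.memLp s (Ioo_subset_Icc_self hs)).integrable one_le_two)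
      ((hv.memLp s (Ioo_subset_Icc_self hs)).integrable one_le_two)
  have hgT : ∫⁻ s in Ioo 0 T, g s < ∞ := by
    calc ∫⁻ s in Ioo 0 T, g s ≤ ∫⁻ s in Ioo 0 T, (2 * FunctionSpaces.Torus.eGradNormSq (u s) +
          2 * FunctionSpaces.Torus.eGradNormSq (v s)) := setLIntegral_mono' measurableSet_Ioo hg_le
      _ = 2 * (∫⁻ s in Ioo 0 T, FunctionSpaces.Torus.eGradNormSq (u s)) +
          2 * ∫⁻ s in Ioo 0 T, FunctionSpaces.Torus.eGradNormSq (v s) := by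
          rw [lintegral_add_left' (hu.aemeasurable_eGradNormSq.const_mul _),
            lintegral_const_mul' _ _ ENNReal.ofNat_ne_top, lintegral_const_mul' _ _ ENNReal.ofNat_ne_top]
      _ < ∞ := ENNReal.add_lt_top.2 ⟨ENNReal.mul_lt_top ENNReal.ofNat_lt_top hgu,
          ENNReal.mul_lt_top ENNReal.ofNat_lt_top hgv⟩
  -- ### uniform `L²` bounds on `[0, T]`
  obtain ⟨Mu, hMu, hMu'⟩ := hu.exists_forall_lintegral_enorm_sq_le hν.le hfm hf₂
  obtain ⟨Mv, hMv, hMv'⟩ := hv.exists_forall_lintegral_enorm_sq_le hν.le hfm hf₂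
  have hybound : ∀ t ∈ Ioc 0 T, y t ≤ 2 * Mu + 2 * Mv := by
    intro t ht
    have ht' : t ∈ Icc 0 T := ⟨ht.1.le, ht.2⟩
    have hmu : AEMeasurable (fun x => ‖u t x‖ₑ ^ 2) volume :=
      (hu.memLp t ht').aestronglyMeasurable.enorm.pow_const _
    calc y t ≤ ∫⁻ x, (2 * ‖u t x‖ₑ ^ 2 + 2 * ‖v t x‖ₑ ^ 2) :=
          lintegral_mono fun x => enorm_sub_sq_le_two_mul _ _
      _ = 2 * (∫⁻ x, ‖u t x‖ₑ ^ 2) + 2 * ∫⁻ x, ‖v t x‖ₑ ^ 2 := by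
          rw [lintegral_add_left' (hmu.const_mul _), lintegral_const_mul' _ _ ENNReal.ofNat_ne_top,
            lintegral_const_mul' _ _ ENNReal.ofNat_ne_top]
      _ ≤ 2 * Mu + 2 * Mv := by gcongr <;> [exact hMu' t ht'; exact hMv' t ht']
  -- ### Ladyzhenskaya for `v`: the Grönwall kernel is integrable
  have hVle : ∀ s ∈ Ioo 0 T, V s ≤ C * Mv * FunctionSpaces.Torus.eSobolevNorm 1
      (FunctionSpaces.EuclideanSpace.complexify ∘ v s) ^ 2 := by
    intro s hs
    refine (hCA (v s) (hv.memLp s (Ioo_subset_Icc_self hs))).trans ?_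
    gcongr
    exact hMv' s (Ioo_subset_Icc_self hs)
  have hHv : ∫⁻ s in Ioo 0 T, FunctionSpaces.Torus.eSobolevNorm 1
      (FunctionSpaces.EuclideanSpace.complexify ∘ v s) ^ 2 < ∞ := by
    have h2 := hv.memL2Sobolev.2
    rw [FunctionSpaces.Torus.eL2SobolevNorm] at h2
    by_contra h
    rw [not_lt, top_le_iff] at h
    rw [h, ENNReal.top_rpow_of_pos (by norm_num)] at h2
    exact lt_irrefl _ h2
  have hVT : ∫⁻ s in Ioo 0 T, V s < ∞ := by
    calc ∫⁻ s in Ioo 0 T, V s ≤ ∫⁻ s in Ioo 0 T, C * Mv * FunctionSpaces.Torus.eSobolevNorm 1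
          (FunctionSpaces.EuclideanSpace.complexify ∘ v s) ^ 2 := setLIntegral_mono' measurableSet_Ioo hVle
      _ = C * Mv * ∫⁻ s in Ioo 0 T, FunctionSpaces.Torus.eSobolevNorm 1
          (FunctionSpaces.EuclideanSpace.complexify ∘ v s) ^ 2 :=
          lintegral_const_mul' _ _ (ENNReal.mul_ne_top ENNReal.coe_ne_top hMv)
      _ < ∞ := ENNReal.mul_lt_top (ENNReal.mul_lt_top ENNReal.coe_lt_top hMv.lt_top) hHv
  have haT : ∫⁻ s in Ioo 0 T, a s ≠ ∞ := by
    have : ∫⁻ s in Ioo 0 T, a s = (∫⁻ _ in Ioo 0 T, νe) + K * ∫⁻ s in Ioo 0 T, V s := by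
      rw [ha, lintegral_add_left' aemeasurable_const, lintegral_const_mul' _ _ hKtop]
    rw [this, setLIntegral_const]
    exact ENNReal.add_ne_top.2 ⟨ENNReal.mul_ne_top hνetop measure_Ioo_lt_top.ne,
      ENNReal.mul_ne_top hKtop hVT.ne⟩
  -- ### the pointwise-in-time bound of the trilinear majorant
  have hpt : ∀ s ∈ Ioo 0 T,
      2 * (V s ^ (1 / 4 : ℝ) * (∫⁻ x, ‖u s x - v s x‖ₑ ^ 4) ^ (1 / 4 : ℝ) * g s ^ (1 / 2 : ℝ)) ≤
        νe * g s + a s * y s := by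
    intro s hs
    have hs' : s ∈ Icc 0 T := Ioo_subset_Icc_self hs
    -- Ladyzhenskaya for `w(s)` and `‖w‖²_{H¹} ≤ |w|² + ‖∇w‖²`
    have hL : ∫⁻ x, ‖u s x - v s x‖ₑ ^ 4 ≤ C * y s * (y s + g s) :=
      (hCA (u s - v s) (hwL2 s hs')).trans
        (mul_le_mul' le_rfl (Torus.eSobolevNorm_one_complexify_sq_le (hwL2 s hs')))
    have h14 : (∫⁻ x, ‖u s x - v s x‖ₑ ^ 4) ^ (1 / 4 : ℝ) ≤
        (C : ℝ≥0∞) ^ (1 / 4 : ℝ) * y s ^ (1 / 4 : ℝ) * (y s + g s) ^ (1 / 4 : ℝ) := by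
      calc (∫⁻ x, ‖u s x - v s x‖ₑ ^ 4) ^ (1 / 4 : ℝ) ≤ (C * y s * (y s + g s)) ^ (1 / 4 : ℝ) :=
            ENNReal.rpow_le_rpow hL (by norm_num)
        _ = _ := by
            rw [ENNReal.mul_rpow_of_nonneg _ _ (by norm_num : (0 : ℝ) ≤ 1 / 4),
              ENNReal.mul_rpow_of_nonneg _ _ (by norm_num : (0 : ℝ) ≤ 1 / 4)]
    have hg12 : g s ^ (1 / 2 : ℝ) ≤ (y s + g s) ^ (1 / 2 : ℝ) :=
      ENNReal.rpow_le_rpow le_add_self (by norm_num)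
    set Aq : ℝ≥0∞ := 2 * (C : ℝ≥0∞) ^ (1 / 4 : ℝ) * V s ^ (1 / 4 : ℝ) * y s ^ (1 / 4 : ℝ) with hAq
    have hmaj : 2 * (V s ^ (1 / 4 : ℝ) * (∫⁻ x, ‖u s x - v s x‖ₑ ^ 4) ^ (1 / 4 : ℝ) * g s ^ (1 / 2 : ℝ)) ≤
        Aq * (y s + g s) ^ (3 / 4 : ℝ) := by
      have h34 : (y s + g s) ^ (3 / 4 : ℝ) = (y s + g s) ^ (1 / 4 : ℝ) * (y s + g s) ^ (1 / 2 : ℝ) := by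
        rw [← ENNReal.rpow_add_of_nonneg _ _ (by norm_num) (by norm_num)]
        norm_num
      calc 2 * (V s ^ (1 / 4 : ℝ) * (∫⁻ x, ‖u s x - v s x‖ₑ ^ 4) ^ (1 / 4 : ℝ) * g s ^ (1 / 2 : ℝ))
          ≤ 2 * (V s ^ (1 / 4 : ℝ) * ((C : ℝ≥0∞) ^ (1 / 4 : ℝ) * y s ^ (1 / 4 : ℝ) *
              (y s + g s) ^ (1 / 4 : ℝ)) * (y s + g s) ^ (1 / 2 : ℝ)) := by gcongr
        _ = Aq * (y s + g s) ^ (3 / 4 : ℝ) := by rw [hAq, h34]; ring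
    have hYoung := ENNReal.mul_rpow_three_quarters_le Aq (y s + g s) νe hνe0 hνetop
    have hA4 : Aq ^ (4 : ℝ) = 16 * C * V s * y s := by
      rw [hAq, ENNReal.mul_rpow_of_nonneg _ _ (by norm_num : (0 : ℝ) ≤ 4),
        ENNReal.mul_rpow_of_nonneg _ _ (by norm_num : (0 : ℝ) ≤ 4),
        ENNReal.mul_rpow_of_nonneg _ _ (by norm_num : (0 : ℝ) ≤ 4), ← ENNReal.rpow_mul,
        ← ENNReal.rpow_mul, ← ENNReal.rpow_mul]
      have h2 : (2 : ℝ≥0∞) ^ (4 : ℝ) = 16 := by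
        rw [show (4 : ℝ) = (4 : ℕ) by norm_num, ENNReal.rpow_natCast]; norm_num
      rw [h2]
      norm_num
    calc 2 * (V s ^ (1 / 4 : ℝ) * (∫⁻ x, ‖u s x - v s x‖ₑ ^ 4) ^ (1 / 4 : ℝ) * g s ^ (1 / 2 : ℝ))
        ≤ Aq * (y s + g s) ^ (3 / 4 : ℝ) := hmaj
      _ ≤ νe * (y s + g s) + νe⁻¹ ^ (3 : ℝ) * Aq ^ (4 : ℝ) := hYoung
      _ = νe * g s + a s * y s := by rw [hA4, ha, hK]; ring
  -- ### absorption: `|w(t)|² ≤ ∫₀ᵗ a |w|²`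
  have hmain : ∀ t ∈ Ioc 0 T, y t ≤ 1 * ∫⁻ s in Ioo 0 t, a s * y s := by
    intro t ht
    rw [one_mul]
    have hsub : Ioo 0 t ⊆ Ioo 0 T := Ioo_subset_Ioo le_rfl ht.2
    set G : ℝ≥0∞ := ∫⁻ s in Ioo 0 t, g s with hG
    have hGtop : G ≠ ∞ := ((lintegral_mono_set hsub).trans_lt hgT).ne
    have hay : AEMeasurable (fun s => a s * y s) (volume.restrict (Ioo 0 t)) :=
      (ha_meas.mul hy_meas).mono_measure (Measure.restrict_mono hsub le_rfl)
    have e1 : y t + 2 * νe * G ≤ 2 * ∫⁻ s in Ioo 0 t, V s ^ (1 / 4 : ℝ) *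
        (∫⁻ x, ‖u s x - v s x‖ₑ ^ 4) ^ (1 / 4 : ℝ) * g s ^ (1 / 2 : ℝ) := HD t ht
    have e2 : 2 * (∫⁻ s in Ioo 0 t, V s ^ (1 / 4 : ℝ) *
        (∫⁻ x, ‖u s x - v s x‖ₑ ^ 4) ^ (1 / 4 : ℝ) * g s ^ (1 / 2 : ℝ)) ≤
        νe * G + ∫⁻ s in Ioo 0 t, a s * y s := by
      rw [← lintegral_const_mul' _ _ ENNReal.ofNat_ne_top]
      calc ∫⁻ s in Ioo 0 t, 2 * (V s ^ (1 / 4 : ℝ) *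
            (∫⁻ x, ‖u s x - v s x‖ₑ ^ 4) ^ (1 / 4 : ℝ) * g s ^ (1 / 2 : ℝ))
          ≤ ∫⁻ s in Ioo 0 t, (νe * g s + a s * y s) :=
            setLIntegral_mono' measurableSet_Ioo fun s hs => hpt s (hsub hs)
        _ = νe * G + ∫⁻ s in Ioo 0 t, a s * y s := by
            rw [lintegral_add_right' _ hay, lintegral_const_mul' _ _ hνetop]
    have e3 : νe * G + (y t + νe * G) ≤ νe * G + ∫⁻ s in Ioo 0 t, a s * y s := by
      calc νe * G + (y t + νe * G) = y t + 2 * νe * G := by ring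
        _ ≤ _ := e1.trans e2
    have e4 : y t + νe * G ≤ ∫⁻ s in Ioo 0 t, a s * y s :=
      (ENNReal.add_le_add_iff_left (ENNReal.mul_ne_top hνetop hGtop)).1 e3
    exact le_self_add.trans e4
  -- ### Grönwall, and conclusion
  intro t ht
  have hM : 2 * Mu + 2 * Mv ≠ ∞ := ENNReal.add_ne_top.2
    ⟨ENNReal.mul_ne_top ENNReal.ofNat_ne_top hMu, ENNReal.mul_ne_top ENNReal.ofNat_ne_top hMv⟩
  have hy0 : y t = 0 :=
    lintegral_gronwall_eq_zero (φ := y) (a := a) (C := 1) ENNReal.one_ne_top hM hybound haT hmain t ht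
  have ht' : t ∈ Icc 0 T := ⟨ht.1.le, ht.2⟩
  have hmw : AEMeasurable (fun x => ‖u t x - v t x‖ₑ ^ 2) volume :=
    (hwL2 t ht').aestronglyMeasurable.enorm.pow_const _
  have hae : (fun x => ‖u t x - v t x‖ₑ ^ 2) =ᵐ[volume] 0 := (lintegral_eq_zero_iff' hmw).1 hy0
  filter_upwards [hae] with x hx
  simpa [sub_eq_zero] using hx

end Literature.Analysis.FluidPDE
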